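import Summits.SmoothPoincare4.SmoothPoincare4.Theorems.SymplecticOrigamiFoldedSphereFoldExistenceSphere
import Summits.SmoothPoincare4.SmoothPoincare4.Theorems.SymplecticOrigamiFoldedSphereFoldExistenceFoldPullback

/-!
# The equatorial stereographic chart of `S⁴` as a chart of the maximal atlas

Helper file for item `FoldedSphereFoldExistence` (route SymplecticOrigami), towards the
non-vacuity witness of the named fact
`Literature.Topology.FourManifolds.eliashberg_foldMap_homotopySphere_four` at the round sphere:
the stereographic projection from the south pole onto the equatorial hyperplane,
`σ(x) = x' / (1 + x₄)` (`x = (x', x₄) ∈ S⁴ ⊂ ℝ⁴ × ℝ`), whose inverse is the embedding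
`e(y) = (2y, 1 - ‖y‖²)/(1 + ‖y‖²)` of `…Sphere.lean`, packaged as an `OpenPartialHomeomorph`
(`stereoSouth`), shown to lie in the maximal `C^∞` atlas of Mathlib's `S⁴`
(`stereoSouth_mem_maximalAtlas`); and the vertical projection `f(x) = x'` (`projFour`), which is
regular off the equator (`injective_mfderiv_projFour_sphere`) and reads
`y ↦ 2y/(1 + ‖y‖²)` in the chart.
-/

noncomputable section

-- the prescribed namespace `Summit.<P>.<Sub>.…` duplicates `SmoothPoincare4` (P = Sub)
set_option linter.dupNamespace false

open scoped Manifold ContDiff Topology InnerProductSpace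
open Set Function Metric
open Literature.Geometry.Symplectic

namespace Summit.SmoothPoincare4.SmoothPoincare4.Theorems.FoldedSphereFoldExistence

/-! ### The vertical projection `ℝ⁵ → ℝ⁴` -/

/-- The vertical projection `(x₀, …, x₄) ↦ (x₀, …, x₃)` as a linear map. [folklore] -/
def projFourₗ : EuclideanSpace ℝ (Fin 5) →ₗ[ℝ] EuclideanSpace ℝ (Fin 4) where
  toFun z := WithLp.toLp 2 ![z 0, z 1, z 2, z 3]
  map_add' z w := by
    ext i
    fin_cases i <;> simp
  map_smul' c z := by
    ext i
    fin_cases i <;> simp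

/-- The vertical projection `ℝ⁵ → ℝ⁴` as a continuous linear map. [folklore] -/
def projFour : EuclideanSpace ℝ (Fin 5) →L[ℝ] EuclideanSpace ℝ (Fin 4) :=
  LinearMap.toContinuousLinearMap projFourₗ

/-- `(P z)₀ = z₀`. [folklore] -/
@[simp] theorem projFour_apply_zero (z : EuclideanSpace ℝ (Fin 5)) : projFour z 0 = z 0 := rfl
/-- `(P z)₁ = z₁`. [folklore] -/
@[simp] theorem projFour_apply_one (z : EuclideanSpace ℝ (Fin 5)) : projFour z 1 = z 1 := rfl
/-- `(P z)₂ = z₂`. [folklore] -/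
@[simp] theorem projFour_apply_two (z : EuclideanSpace ℝ (Fin 5)) : projFour z 2 = z 2 := rfl
/-- `(P z)₃ = z₃`. [folklore] -/
@[simp] theorem projFour_apply_three (z : EuclideanSpace ℝ (Fin 5)) : projFour z 3 = z 3 := rfl

/-- `P ∘ pad = id`. [folklore] -/
@[simp] theorem projFour_padFive (y : EuclideanSpace ℝ (Fin 4)) : projFour (padFive y) = y := by
  ext i
  fin_cases i <;> rfl

/-- `P e₄ = 0`. [folklore] -/
@[simp] theorem projFour_single_four :
    projFour (EuclideanSpace.single (4 : Fin 5) (1 : ℝ)) = 0 := by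
  ext i
  fin_cases i <;> simp [projFour, projFourₗ]

/-- The vertical projection of the inverse stereographic projection:
`P (e y) = (2 / (1 + ‖y‖²)) y`. [folklore] -/
theorem projFour_stereoInvSouth (y : EuclideanSpace ℝ (Fin 4)) :
    projFour ((1 + ‖y‖ ^ 2)⁻¹ • ((2 : ℝ) • padFive y +
      (1 - ‖y‖ ^ 2) • EuclideanSpace.single (4 : Fin 5) (1 : ℝ))) = (2 / (1 + ‖y‖ ^ 2)) • y := by
  rw [map_smul, map_add, map_smul, map_smul, projFour_padFive, projFour_single_four, smul_zero,
    add_zero, smul_smul]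
  congr 1
  ring

/-! ### The equatorial stereographic chart -/

/-- On the sphere, `‖x'‖² = 1 - x₄²`. [folklore] -/
theorem sum_sq_four_eq (x : sphere (0 : EuclideanSpace ℝ (Fin 5)) 1) :
    (x : EuclideanSpace ℝ (Fin 5)) 0 ^ 2 + (x : EuclideanSpace ℝ (Fin 5)) 1 ^ 2 +
      (x : EuclideanSpace ℝ (Fin 5)) 2 ^ 2 + (x : EuclideanSpace ℝ (Fin 5)) 3 ^ 2 =
        1 - (x : EuclideanSpace ℝ (Fin 5)) 4 ^ 2 := by
  have h1 : ‖(x : EuclideanSpace ℝ (Fin 5))‖ ^ 2 = 1 := by rw [norm_eq_of_mem_sphere x, one_pow]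
  rw [EuclideanSpace.real_norm_sq_eq, Fin.sum_univ_five] at h1
  linarith

/-- The squared norm of the stereographic image: `‖x'/(1+x₄)‖² = (1 - x₄)/(1 + x₄)`. [folklore] -/
theorem norm_sq_stereoSouthFun (x : sphere (0 : EuclideanSpace ℝ (Fin 5)) 1)
    (hx : 1 + (x : EuclideanSpace ℝ (Fin 5)) 4 ≠ 0) :
    ‖(1 + (x : EuclideanSpace ℝ (Fin 5)) 4)⁻¹ • projFour (x : EuclideanSpace ℝ (Fin 5))‖ ^ 2 =
      (1 - (x : EuclideanSpace ℝ (Fin 5)) 4) / (1 + (x : EuclideanSpace ℝ (Fin 5)) 4) := by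
  rw [norm_smul, mul_pow, EuclideanSpace.real_norm_sq_eq, Fin.sum_univ_four]
  simp only [projFour_apply_zero, projFour_apply_one, projFour_apply_two, projFour_apply_three]
  rw [sum_sq_four_eq x, Real.norm_eq_abs, sq_abs]
  field_simp
  ring

/-- `e (σ x) = x` on the sphere off the south pole. [folklore] -/
theorem stereoInvSouth_stereoSouth (x : sphere (0 : EuclideanSpace ℝ (Fin 5)) 1)
    (hx : 1 + (x : EuclideanSpace ℝ (Fin 5)) 4 ≠ 0) :
    (1 + ‖(1 + (x : EuclideanSpace ℝ (Fin 5)) 4)⁻¹ • projFour (x : EuclideanSpace ℝ (Fin 5))‖ ^ 2)⁻¹ •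
      ((2 : ℝ) • padFive ((1 + (x : EuclideanSpace ℝ (Fin 5)) 4)⁻¹ •
        projFour (x : EuclideanSpace ℝ (Fin 5))) +
      (1 - ‖(1 + (x : EuclideanSpace ℝ (Fin 5)) 4)⁻¹ • projFour (x : EuclideanSpace ℝ (Fin 5))‖ ^ 2) •
        EuclideanSpace.single (4 : Fin 5) (1 : ℝ)) = (x : EuclideanSpace ℝ (Fin 5)) := by
  rw [norm_sq_stereoSouthFun x hx]
  have h2 : (1 : ℝ) + (1 - (x : EuclideanSpace ℝ (Fin 5)) 4) / (1 + (x : EuclideanSpace ℝ (Fin 5)) 4) =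
      2 / (1 + (x : EuclideanSpace ℝ (Fin 5)) 4) := by
    field_simp
    ring
  have h3 : (1 : ℝ) - (1 - (x : EuclideanSpace ℝ (Fin 5)) 4) / (1 + (x : EuclideanSpace ℝ (Fin 5)) 4) =
      2 * (x : EuclideanSpace ℝ (Fin 5)) 4 / (1 + (x : EuclideanSpace ℝ (Fin 5)) 4) := by
    field_simp
    ring
  rw [h2, h3]
  ext j
  fin_cases j <;> simp <;> field_simp

/-- **The equatorial stereographic chart** of `S⁴` (projection from the south pole
`(0,0,0,0,-1)` onto the equatorial hyperplane), `σ(x) = x'/(1 + x₄)`, with inverse the embedding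
`e(y) = (2y, 1 - ‖y‖²)/(1 + ‖y‖²)`. [folklore] -/
def stereoSouth : OpenPartialHomeomorph (sphere (0 : EuclideanSpace ℝ (Fin 5)) 1)
    (EuclideanSpace ℝ (Fin 4)) where
  toFun x := (1 + (x : EuclideanSpace ℝ (Fin 5)) 4)⁻¹ • projFour (x : EuclideanSpace ℝ (Fin 5))
  invFun y := Set.codRestrict (fun y : EuclideanSpace ℝ (Fin 4) =>
    (1 + ‖y‖ ^ 2)⁻¹ • ((2 : ℝ) • padFive y +
      (1 - ‖y‖ ^ 2) • EuclideanSpace.single (4 : Fin 5) (1 : ℝ))) _ stereoInvSouth_mem_sphere y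
  source := {x | 1 + (x : EuclideanSpace ℝ (Fin 5)) 4 ≠ 0}
  target := univ
  map_source' := fun _ _ => mem_univ _
  map_target' := by
    intro y _
    show 1 + ((1 + ‖y‖ ^ 2)⁻¹ • ((2 : ℝ) • padFive y +
      (1 - ‖y‖ ^ 2) • EuclideanSpace.single (4 : Fin 5) (1 : ℝ))) 4 ≠ 0
    have h : ((1 + ‖y‖ ^ 2)⁻¹ • ((2 : ℝ) • padFive y +
        (1 - ‖y‖ ^ 2) • EuclideanSpace.single (4 : Fin 5) (1 : ℝ))) 4 =
          (1 - ‖y‖ ^ 2) / (1 + ‖y‖ ^ 2) := by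
      simp
      ring
    rw [h]
    have h2 : 1 + (1 - ‖y‖ ^ 2) / (1 + ‖y‖ ^ 2) = 2 / (1 + ‖y‖ ^ 2) := by
      field_simp
      ring
    rw [h2]
    positivity
  left_inv' := by
    intro x hx
    apply Subtype.ext
    exact stereoInvSouth_stereoSouth x hx
  right_inv' := by
    intro y _
    simp only [val_codRestrict_apply]
    exact stereoSouth_stereoInvSouth y
  open_source := by
    have hc : Continuous fun x : sphere (0 : EuclideanSpace ℝ (Fin 5)) 1 =>
        1 + (x : EuclideanSpace ℝ (Fin 5)) 4 :=
      continuous_const.add ((continuous_apply 4).comp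
        ((PiLp.continuous_ofLp 2 _).comp continuous_subtype_val))
    exact isOpen_ne_fun hc continuous_const
  open_target := isOpen_univ
  continuousOn_toFun := by
    refine continuousOn_of_forall_continuousAt fun x hx => ?_
    have h1 : ContinuousAt (fun x : sphere (0 : EuclideanSpace ℝ (Fin 5)) 1 =>
        (1 + (x : EuclideanSpace ℝ (Fin 5)) 4)⁻¹) x := by
      refine ContinuousAt.inv₀ ?_ hx
      exact (continuous_const.add ((continuous_apply 4).comp
        ((PiLp.continuous_ofLp 2 _).comp continuous_subtype_val))).continuousAt
    exact h1.smul (projFour.continuous.comp continuous_subtype_val).continuousAt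
  continuousOn_invFun := by
    exact (contDiff_stereoInvSouth.continuous.subtype_mk _).continuousOn

/-- The chart as a function. [folklore] -/
theorem stereoSouth_apply (x : sphere (0 : EuclideanSpace ℝ (Fin 5)) 1) :
    stereoSouth x = (1 + (x : EuclideanSpace ℝ (Fin 5)) 4)⁻¹ • projFour (x : EuclideanSpace ℝ (Fin 5)) :=
  rfl

/-- The inverse chart on underlying vectors is the inverse stereographic projection `e`.
[folklore] -/
theorem coe_stereoSouth_symm_apply (y : EuclideanSpace ℝ (Fin 4)) :
    ((stereoSouth.symm y : sphere (0 : EuclideanSpace ℝ (Fin 5)) 1) : EuclideanSpace ℝ (Fin 5)) =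
      (1 + ‖y‖ ^ 2)⁻¹ • ((2 : ℝ) • padFive y +
        (1 - ‖y‖ ^ 2) • EuclideanSpace.single (4 : Fin 5) (1 : ℝ)) :=
  rfl

/-- The source of the chart: the sphere minus the south pole. [folklore] -/
theorem stereoSouth_source :
    stereoSouth.source = {x : sphere (0 : EuclideanSpace ℝ (Fin 5)) 1 |
      1 + (x : EuclideanSpace ℝ (Fin 5)) 4 ≠ 0} := rfl

/-- The target of the chart is all of `ℝ⁴`. [folklore] -/
theorem stereoSouth_target : stereoSouth.target = univ := rfl

/-- The inverse chart is `C^∞` (as a map into Mathlib's `S⁴`). [folklore] -/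
theorem contMDiff_stereoSouth_symm :
    ContMDiff 𝓘(ℝ, EuclideanSpace ℝ (Fin 4)) (𝓡 4) ∞ stereoSouth.symm := by
  haveI : Fact (Module.finrank ℝ (EuclideanSpace ℝ (Fin 5)) = 4 + 1) := ⟨finrank_euclideanSpace_fin⟩
  exact contDiff_stereoInvSouth.contMDiff.codRestrict_sphere stereoInvSouth_mem_sphere

/-- The chart is `C^∞` on its source. [folklore] -/
theorem contMDiffOn_stereoSouth :
    ContMDiffOn (𝓡 4) 𝓘(ℝ, EuclideanSpace ℝ (Fin 4)) ∞ stereoSouth stereoSouth.source := by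
  haveI : Fact (Module.finrank ℝ (EuclideanSpace ℝ (Fin 5)) = 4 + 1) := ⟨finrank_euclideanSpace_fin⟩
  intro x hx
  have hx' : 1 + (x : EuclideanSpace ℝ (Fin 5)) 4 ≠ 0 := hx
  have hG : ContDiffAt ℝ ∞ (fun z : EuclideanSpace ℝ (Fin 5) => (1 + z 4)⁻¹ • projFour z)
      (x : EuclideanSpace ℝ (Fin 5)) := by
    have h2 : ContDiff ℝ ∞ fun z : EuclideanSpace ℝ (Fin 5) => 1 + z 4 :=
      contDiff_const.add (contDiff_piLp_apply (p := 2) (i := (4 : Fin 5)))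
    have h1 : ContDiffAt ℝ ∞ (fun z : EuclideanSpace ℝ (Fin 5) => (1 + z 4)⁻¹)
        (x : EuclideanSpace ℝ (Fin 5)) :=
      (contDiffAt_inv ℝ hx').comp (x : EuclideanSpace ℝ (Fin 5)) h2.contDiffAt
    exact h1.smul projFour.contDiff.contDiffAt
  exact (hG.contMDiffAt.comp x (contMDiff_coe_sphere (E := EuclideanSpace ℝ (Fin 5)) (n := 4) x))
    |>.contMDiffWithinAt

/-- **The equatorial stereographic chart belongs to the maximal `C^∞` atlas of `S⁴`.**
[folklore] -/
theorem stereoSouth_mem_maximalAtlas :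
    stereoSouth ∈ IsManifold.maximalAtlas (𝓡 4) ∞ (sphere (0 : EuclideanSpace ℝ (Fin 5)) 1) :=
  stereoSouth.mem_maximalAtlas_of_contMDiffOn contMDiffOn_stereoSouth
    contMDiff_stereoSouth_symm.contMDiffOn

/-- The inverse chart `e = σ⁻¹ : ℝ⁴ → S⁴` is a topological embedding. [folklore] -/
theorem isEmbedding_stereoSouth_symm : Topology.IsEmbedding stereoSouth.symm :=
  (stereoSouth.symm.to_isOpenEmbedding stereoSouth_target).isEmbedding

/-- The inverse chart `e = σ⁻¹` has injective differential everywhere. [folklore] -/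
theorem injective_mfderiv_stereoSouth_symm (y : EuclideanSpace ℝ (Fin 4)) :
    Injective (mfderiv 𝓘(ℝ, EuclideanSpace ℝ (Fin 4)) (𝓡 4) stereoSouth.symm y) := by
  have hmd := (mdifferentiable_of_mem_maximalAtlas' stereoSouth_mem_maximalAtlas).symm
  exact hmd.mfderiv_injective (by simp [stereoSouth_target])

/-! ### The vertical projection of the sphere is regular off the equator -/

/-- Two vectors orthogonal to `x` (with `x₄ ≠ 0`) with the same vertical projection are equal:
their difference lies in `ker P ∩ x^⊥ = ℝ e₄ ∩ x^⊥ = 0`. [folklore] -/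
theorem eq_of_projFour_eq_of_inner_eq_zero {x V W : EuclideanSpace ℝ (Fin 5)} (hx : x 4 ≠ 0)
    (hV : ⟪x, V⟫_ℝ = 0) (hW : ⟪x, W⟫_ℝ = 0) (h : projFour V = projFour W) : V = W := by
  have hD : projFour (V - W) = 0 := by rw [map_sub, h, sub_self]
  have hD' : ⟪x, V - W⟫_ℝ = 0 := by rw [inner_sub_right, hV, hW, sub_self]
  set D := V - W with hDdef
  have h0 : D 0 = 0 := by simpa using congrArg (fun z : EuclideanSpace ℝ (Fin 4) => z 0) hD
  have h1 : D 1 = 0 := by simpa using congrArg (fun z : EuclideanSpace ℝ (Fin 4) => z 1) hD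
  have h2 : D 2 = 0 := by simpa using congrArg (fun z : EuclideanSpace ℝ (Fin 4) => z 2) hD
  have h3 : D 3 = 0 := by simpa using congrArg (fun z : EuclideanSpace ℝ (Fin 4) => z 3) hD
  have h4 : D 4 = 0 := by
    rw [PiLp.inner_apply, Fin.sum_univ_five] at hD'
    simp only [h0, h1, h2, h3, RCLike.inner_apply, conj_trivial, zero_mul, zero_add] at hD'
    rcases mul_eq_zero.1 hD' with h' | h'
    · exact h'
    · exact absurd h' hx
  have hD0 : D = 0 := by
    ext j
    fin_cases j
    · exact h0
    · exact h1
    · exact h2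
    · exact h3
    · exact h4
  exact sub_eq_zero.1 hD0

/-- **The vertical projection `x ↦ x'` of `S⁴` has injective differential at every point with
`x₄ ≠ 0`**: its differential is `P ∘ dι` with `range dι = x^⊥`, and `ker P ∩ x^⊥ = ℝ e₄ ∩ x^⊥ = 0`
when `x₄ ≠ 0`. [folklore] -/
theorem injective_mfderiv_projFour_sphere (x : sphere (0 : EuclideanSpace ℝ (Fin 5)) 1)
    (hx : (x : EuclideanSpace ℝ (Fin 5)) 4 ≠ 0) :
    Injective (mfderiv (𝓡 4) (𝓡 4)
      (fun x : sphere (0 : EuclideanSpace ℝ (Fin 5)) 1 => projFour (x : EuclideanSpace ℝ (Fin 5))) x) := by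
  haveI : Fact (Module.finrank ℝ (EuclideanSpace ℝ (Fin 5)) = 4 + 1) := ⟨finrank_euclideanSpace_fin⟩
  have hval : MDifferentiableAt (𝓡 4) 𝓘(ℝ, EuclideanSpace ℝ (Fin 5))
      (Subtype.val : sphere (0 : EuclideanSpace ℝ (Fin 5)) 1 → EuclideanSpace ℝ (Fin 5)) x :=
    (contMDiff_coe_sphere (E := EuclideanSpace ℝ (Fin 5)) (n := 4) (m := ∞) x).mdifferentiableAt
      (by simp)
  have hP : MDifferentiableAt 𝓘(ℝ, EuclideanSpace ℝ (Fin 5)) (𝓡 4)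
      (fun z : EuclideanSpace ℝ (Fin 5) => projFour z) (x : EuclideanSpace ℝ (Fin 5)) :=
    (projFour.contMDiff (n := ∞)).mdifferentiableAt (by simp)
  have hc := mfderiv_comp x hP hval
  have hPd : mfderiv 𝓘(ℝ, EuclideanSpace ℝ (Fin 5)) (𝓡 4) (fun z : EuclideanSpace ℝ (Fin 5) =>
      projFour z) (x : EuclideanSpace ℝ (Fin 5)) = projFour := ContinuousLinearMap.mfderiv_eq _
  have hc' : ∀ v, mfderiv (𝓡 4) (𝓡 4) (fun x : sphere (0 : EuclideanSpace ℝ (Fin 5)) 1 =>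
      projFour (x : EuclideanSpace ℝ (Fin 5))) x v =
        projFour (mfderiv (𝓡 4) 𝓘(ℝ, EuclideanSpace ℝ (Fin 5)) Subtype.val x v) := fun v => by
    have h := congrArg (fun T => T v) hc
    rw [hPd] at h
    exact h
  intro v w hvw
  rw [hc', hc'] at hvw
  have hmem : ∀ u, ⟪((x : sphere (0 : EuclideanSpace ℝ (Fin 5)) 1) : EuclideanSpace ℝ (Fin 5)),
      (mfderiv (𝓡 4) 𝓘(ℝ, EuclideanSpace ℝ (Fin 5)) Subtype.val x u :
        EuclideanSpace ℝ (Fin 5))⟫_ℝ = 0 := fun u =>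
    Submodule.mem_orthogonal_singleton_iff_inner_right.1
      ((range_mfderiv_coe_sphere (n := 4) x).le (LinearMap.mem_range_self _ u))
  have hinj := mfderiv_coe_sphere_injective (E := EuclideanSpace ℝ (Fin 5)) (n := 4) x
  exact hinj (eq_of_projFour_eq_of_inner_eq_zero hx (hmem v) (hmem w) hvw)

end Summit.SmoothPoincare4.SmoothPoincare4.Theorems.FoldedSphereFoldExistence

end
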